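import Summits.CriticalPhenomena.PercolationContinuityZ3.Theorems.PercNearOneGluingNoHeavyRsw3SlabTwoSpanningWindowAspect
import Summits.CriticalPhenomena.PercolationContinuityZ3.Theorems.PercNearOneGluingNoHeavyRsw3SlabPlateRenormalizationOverlap
import HarnessLib

/-!
# RSW3 lane (P2, gen 13): FEW SPANNING CLUSTERS FORCE PERCOLATION at every lateral size `A ≥ n + 1` — the every-`p` two-spanning
# lower bound with overlapping cells, and its form on `[0, p_c]`

builds on p205010 (kernel theorem, internal audit signed; external expert review pending)

Cell `prim-rsw3`, prover seat `prim-rsw3-p2` (gen 13), memo `run/shared/lean/prim/rsw3/P2-RSWLITE.md` §19.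
Support file (`--supports stmt-CriticalPhenomena-4575`); no definitions, no named facts, no sorries.

`le_real_twoSpan_of_theta_eq_zero_overlap` (every `p` with `θ(p) = 0`): for a layout `(n, w, s₀, s₁, A, B, r)` with `1 ≤ n`, `1 ≤ s₀`,
`1 ≤ s₁`, `A = s₁ + n`, `2w + n + s₀ ≤ A`, `r s₀ ≥ n + 1`, `(r+1) s₁ ≥ n + 2 s₁ + 1` and `Δ = δ_r^{(r+1)²}`, `σ = P_p(boxCross (n, w, B) 0)`:

  `min(Δ/8, σ² Δ/2) ≤ P_p(TwoSpan({0..n} × {0..A} × {0..B}))`,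

otherwise the seal with free widths (gen 12, `sq_mul_real_compl_boxCross_le_real_twoSpan_aspect`), the swap (`real_boxCross_swap_le`) and the
plate renormalisation with OVERLAPPING cells (`theta_pos_of_plate_slabUniq_criterion_overlap`) give `θ(p) > 0`.  Compared with gen 12's
`le_real_twoSpan_of_theta_eq_zero_aspect` the hypothesis `A ≥ 2n + 1` is gone: every `A ≥ n + 1 + 2w` is admissible, the price being a
range `r ≍ n/s₁` in `Δ`.  `le_real_twoSpan_of_le_criticalProb_overlap`: the same for every `p ≤ p_c(ℤ³)` (`θ(p) ≤ θ(p_c) = 0`,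
p205010).  The `p = p_c` specialisation with the hard-tube floors of gen 7 for the (semi-hard) sub-block `{0..n} × {0..w} × {0..B}`,
`w ≈ n/q`, is `…Rsw3SlabTwoSpanningPolynomial` — polynomial two-spanning floors on the whole strip `t₁ < 1`.

References: M. Aizenman, Nucl. Phys. B 485 (1997) 551–582, §2 Thm. 2, Remark 1, criterion (ii) [Aizenman1997]; G. Grimmett, *Percolation* (1999),
§7.4 [GrimmettPercolation1999]. [folklore]
-/

noncomputable section

namespace Summit.CriticalPhenomena.PercolationContinuityZ3.Theorems.Rsw3

open MeasureTheory Literature.Probability.LatticeModels Literature.Probability.Percolation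
open Summit.CriticalPhenomena.PercolationContinuityZ3.Theorems.Crossing SurfaceTension

/-- **Few spanning clusters force percolation, EVERY lateral size `A ≥ n + 1` (every `p` with `θ(p) = 0`).**  For
`n w s₀ s₁ A B r : ℕ` with `1 ≤ n`, `1 ≤ s₀`, `1 ≤ s₁`, `s₁ + n = A`, `2w + (n + s₀) ≤ A`, `n + 1 ≤ r s₀`, `n + 2 s₁ + 1 ≤ (r+1) s₁`:
`min(Δ/8, σ²Δ/2) ≤ P_p(TwoSpan(Icc 0 (n, A, B)))`, `Δ = δ_r^{(r+1)²}`, `δ_r = 1/(2((r+1)²+2)(2·10²)^{(r+1)²})`, `σ = P_p(boxCross (n, w, B) 0)`.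
[cite: Aizenman1997, §2 criterion (ii) and Thm. 2] -/
theorem le_real_twoSpan_of_theta_eq_zero_overlap (p : unitInterval) (hθ : theta (zdGraph 3) (0 : Site 3) p = 0) {n w s₀ s₁ A B r : ℕ}
    (hn : 1 ≤ n) (hs₀ : 1 ≤ s₀) (hs₁ : 1 ≤ s₁) (hA : s₁ + n = A) (hwA : 2 * w + (n + s₀) ≤ A) (hrs : n + 1 ≤ r * s₀)
    (hrs₁ : n + 2 * s₁ + 1 ≤ (r + 1) * s₁) :
    min ((1 / (2 * (((r : ℝ) + 1) ^ 2 + 2) * (2 * (3 ^ 2 + 1 : ℝ) ^ 2) ^ ((r + 1) ^ 2))) ^ ((r + 1) ^ 2) / 8)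
        ((bondPercolation (zdGraph 3) p).real (boxCross ![(n : ℤ), (w : ℤ), (B : ℤ)] 0) ^ 2 *
          (1 / (2 * (((r : ℝ) + 1) ^ 2 + 2) * (2 * (3 ^ 2 + 1 : ℝ) ^ 2) ^ ((r + 1) ^ 2))) ^ ((r + 1) ^ 2) / 2) ≤
      (bondPercolation (zdGraph 3) p).real
        {ω : BondConfig (Site 3) | ∃ x ∈ Finset.Icc (0 : Site 3) ![(n : ℤ), (A : ℤ), (B : ℤ)],
            ∃ x' ∈ Finset.Icc (0 : Site 3) ![(n : ℤ), (A : ℤ), (B : ℤ)],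
            ∃ y ∈ Finset.Icc (0 : Site 3) ![(n : ℤ), (A : ℤ), (B : ℤ)], ∃ y' ∈ Finset.Icc (0 : Site 3) ![(n : ℤ), (A : ℤ), (B : ℤ)],
            x 0 = 0 ∧ x' 0 = 0 ∧ y 0 = (n : ℤ) ∧ y' 0 = (n : ℤ) ∧
            ω ∈ inConn ↑(Finset.Icc (0 : Site 3) ![(n : ℤ), (A : ℤ), (B : ℤ)]) x y ∧
            ω ∈ inConn ↑(Finset.Icc (0 : Site 3) ![(n : ℤ), (A : ℤ), (B : ℤ)]) x' y' ∧
            ω ∉ inConn ↑(Finset.Icc (0 : Site 3) ![(n : ℤ), (A : ℤ), (B : ℤ)]) x x'} := by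
  set μ := bondPercolation (zdGraph 3) p with hμ
  set Δ : ℝ := (1 / (2 * (((r : ℝ) + 1) ^ 2 + 2) * (2 * (3 ^ 2 + 1 : ℝ) ^ 2) ^ ((r + 1) ^ 2))) ^ ((r + 1) ^ 2) with hΔ
  have hΔpos : 0 < Δ := by rw [hΔ]; positivity
  set σ := μ.real (boxCross ![(n : ℤ), (w : ℤ), (B : ℤ)] 0) with hσ
  set D := μ.real
        {ω : BondConfig (Site 3) | ∃ x ∈ Finset.Icc (0 : Site 3) ![(n : ℤ), (A : ℤ), (B : ℤ)],
            ∃ x' ∈ Finset.Icc (0 : Site 3) ![(n : ℤ), (A : ℤ), (B : ℤ)],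
            ∃ y ∈ Finset.Icc (0 : Site 3) ![(n : ℤ), (A : ℤ), (B : ℤ)], ∃ y' ∈ Finset.Icc (0 : Site 3) ![(n : ℤ), (A : ℤ), (B : ℤ)],
            x 0 = 0 ∧ x' 0 = 0 ∧ y 0 = (n : ℤ) ∧ y' 0 = (n : ℤ) ∧
            ω ∈ inConn ↑(Finset.Icc (0 : Site 3) ![(n : ℤ), (A : ℤ), (B : ℤ)]) x y ∧
            ω ∈ inConn ↑(Finset.Icc (0 : Site 3) ![(n : ℤ), (A : ℤ), (B : ℤ)]) x' y' ∧
            ω ∉ inConn ↑(Finset.Icc (0 : Site 3) ![(n : ℤ), (A : ℤ), (B : ℤ)]) x x'} with hD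
  by_contra hlt
  push Not at hlt
  have hD1 : D < Δ / 8 := lt_of_lt_of_le hlt (min_le_left _ _)
  have hD2 : D < σ ^ 2 * Δ / 2 := lt_of_lt_of_le hlt (min_le_right _ _)
  have hD0 : 0 ≤ D := measureReal_nonneg
  -- (1) the seal
  have hseal := sq_mul_real_compl_boxCross_le_real_twoSpan_aspect p (n := n) (w := w) (g := n + s₀) (A := A) (B := B)
    (by omega) hwA
  rw [← hμ] at hseal
  have hσpos : 0 < σ ^ 2 := by
    by_contra h0
    push Not at h0
    have : σ ^ 2 * Δ / 2 ≤ 0 := by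
      have := mul_nonpos_of_nonpos_of_nonneg h0 hΔpos.le
      linarith
    linarith
  have hlayer : μ.real (boxCross ![(n : ℤ), ((n + s₀ : ℕ) : ℤ), (B : ℤ)] 1)ᶜ < Δ / 2 := by
    by_contra hge
    push Not at hge
    have h1 : σ ^ 2 * (Δ / 2) ≤ σ ^ 2 * μ.real (boxCross ![(n : ℤ), ((n + s₀ : ℕ) : ℤ), (B : ℤ)] 1)ᶜ :=
      mul_le_mul_of_nonneg_left hge (sq_nonneg _)
    have h2 : σ ^ 2 * (Δ / 2) = σ ^ 2 * Δ / 2 := by ring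
    linarith
  -- (2) the swap
  have hswap : μ.real (boxCross ![((n + s₀ : ℕ) : ℤ), (n : ℤ), (B : ℤ)] 0)ᶜ ≤
      μ.real (boxCross ![(n : ℤ), ((n + s₀ : ℕ) : ℤ), (B : ℤ)] 1)ᶜ := by
    rw [probReal_compl_eq_one_sub (measurableSet_boxCross _ _), probReal_compl_eq_one_sub (measurableSet_boxCross _ _)]
    have := real_boxCross_swap_le p (n : ℤ) (B : ℤ) (b := ((n + s₀ : ℕ) : ℤ)) (by positivity)
    rw [← hμ] at this
    linarith
  -- (3) percolation
  have hpos : 0 < theta (zdGraph 3) (0 : Site 3) p :=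
    theta_pos_of_plate_slabUniq_criterion_overlap p (n := n) (s₀ := s₀) (s₁ := s₁) (A := A) (B := B) (r := r) hs₀ hs₁ hA hrs hrs₁
      (by rw [← hμ, ← hΔ]; linarith)
  exact hpos.ne' hθ

/-- **On `[0, p_c(ℤ³)]`, every lateral size `A ≥ n + 1`: two spanning clusters are at least as likely as `c·σ_p²`** — the same bound
for every `p ≤ p_c` (`θ(p) ≤ θ(p_c) = 0`, `theta_mono_holds` and p205010 `CSH.percolationContinuity_allDimensions`).  At `p_c` the factor
`σ_p = P_p(boxCross (n, w, B) 0)` of a sub-block with `w < n` is a semi-hard crossing, bounded below by a polynomial only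
(`…Rsw3SlabTwoSpanningPolynomial`).  builds on p205010 (kernel theorem, internal audit signed; external expert review pending).
[cite: Aizenman1997, §2 Thm. 2 and Remark 1] -/
theorem le_real_twoSpan_of_le_criticalProb_overlap (p : unitInterval) (hp : p ≤ criticalProbI 3) {n w s₀ s₁ A B r : ℕ}
    (hn : 1 ≤ n) (hs₀ : 1 ≤ s₀) (hs₁ : 1 ≤ s₁) (hA : s₁ + n = A) (hwA : 2 * w + (n + s₀) ≤ A) (hrs : n + 1 ≤ r * s₀)
    (hrs₁ : n + 2 * s₁ + 1 ≤ (r + 1) * s₁) :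
    min ((1 / (2 * (((r : ℝ) + 1) ^ 2 + 2) * (2 * (3 ^ 2 + 1 : ℝ) ^ 2) ^ ((r + 1) ^ 2))) ^ ((r + 1) ^ 2) / 8)
        ((bondPercolation (zdGraph 3) p).real (boxCross ![(n : ℤ), (w : ℤ), (B : ℤ)] 0) ^ 2 *
          (1 / (2 * (((r : ℝ) + 1) ^ 2 + 2) * (2 * (3 ^ 2 + 1 : ℝ) ^ 2) ^ ((r + 1) ^ 2))) ^ ((r + 1) ^ 2) / 2) ≤
      (bondPercolation (zdGraph 3) p).real
        {ω : BondConfig (Site 3) | ∃ x ∈ Finset.Icc (0 : Site 3) ![(n : ℤ), (A : ℤ), (B : ℤ)],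
            ∃ x' ∈ Finset.Icc (0 : Site 3) ![(n : ℤ), (A : ℤ), (B : ℤ)],
            ∃ y ∈ Finset.Icc (0 : Site 3) ![(n : ℤ), (A : ℤ), (B : ℤ)], ∃ y' ∈ Finset.Icc (0 : Site 3) ![(n : ℤ), (A : ℤ), (B : ℤ)],
            x 0 = 0 ∧ x' 0 = 0 ∧ y 0 = (n : ℤ) ∧ y' 0 = (n : ℤ) ∧
            ω ∈ inConn ↑(Finset.Icc (0 : Site 3) ![(n : ℤ), (A : ℤ), (B : ℤ)]) x y ∧
            ω ∈ inConn ↑(Finset.Icc (0 : Site 3) ![(n : ℤ), (A : ℤ), (B : ℤ)]) x' y' ∧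
            ω ∉ inConn ↑(Finset.Icc (0 : Site 3) ![(n : ℤ), (A : ℤ), (B : ℤ)]) x x'} := by
  have h0 : theta (zdGraph 3) (0 : Site 3) (criticalProbI 3) = 0 := CSH.percolationContinuity_allDimensions 3 (by norm_num)
  have hmono : theta (zdGraph 3) (0 : Site 3) p ≤ theta (zdGraph 3) (0 : Site 3) (criticalProbI 3) :=
    theta_mono_holds (zdGraph 3) (0 : Site 3) hp
  have hnn : 0 ≤ theta (zdGraph 3) (0 : Site 3) p := by unfold theta; exact measureReal_nonneg
  exact le_real_twoSpan_of_theta_eq_zero_overlap p (by linarith) hn hs₀ hs₁ hA hwA hrs hrs₁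

end Summit.CriticalPhenomena.PercolationContinuityZ3.Theorems.Rsw3

end
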